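import Summits.QuantumFields.YangMills.Theorems.BalabanUVNodesPortS1G3CWalkGeom
import Summits.QuantumFields.YangMills.Theorems.BalabanUVNodesPortS1G3CNearStep

/-!
# NODE O port PT-A — `stub_G3C` (repaired edition `G3CAtRecordL`), layer (α′): THE POINT PREDICATE `G3CPt` — the carrier clauses AT ONE PAIR `φ` with constants `(c, γ)` —
# and the hand's bricks RE-KEYED on it (units, `‖G_Z‖ ≤ 1/γ`, continuity in `x`, the one-sided parametrix), so that they run on an OPEN neighbourhood of the record space

Cell `ym-nodeO-ideate`, porter hand `hand-27930-G3C` (g1); `--supports stmt-QuantumFields-27930`; count-neutral.  [16] = [Balaban1985UV3], [B9] = [Balaban1985BackgroundPropagators],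
[I] = [Balaban1987RG1].

WHY.  Rows (g2)(g3)(g5) of `G3CPiecesAt` (✓`…PortS1G3CDefs`) are asked on an OPEN set `O ⊇ S_X := {φ | encodeCfg φ ∈ recordUc … X}`, while every brick of the g0 hand (✓`…G3CLocOps` …
✓`…G3CWalkGeom`) is keyed by `hφ : encodeCfg φ ∈ recordUc … Z` — it holds ON the record space only (which has empty interior).  The repair (memo §5c «O_X must be BUILT … the clauses DEGRADE
gracefully») is to key the bricks by what they actually use AT THE PAIR `φ`: the lattice-scale Schur row∕column sums of the pieces `T_Y(φ)`, `Y ⊆ X`, and the `Re`-coercivity of the blocks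
`T^{(Z)}(φ)|_Z`, `Z ⊆ X`, with SOME constants `(c, γ)` — the predicate `G3CPt … c γ δ₀ δ₁ X φ` of this file.  On `S_X` it holds with `(c₀, γ₀)` (from (P4-lat) + (P5ᶜ) + ✓`recordUc_antitone`);
on a neighbourhood of `S_X` it holds with `(2c₀, γ₀∕2)` (next file, continuity of finitely many analytic entries); and every estimate of the walk expansion follows from it.

WHAT THIS FILE PROVES (sorry-free): `g3cPt_of_mem` (the predicate on the record space), `G3CPt.mono` (antitone in `X`), and the re-keyed bricks `isUnit_det_g3cLocBlock_of_coer`,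
`norm_g3cLocInv_apply_le_of_coer`, `l2_opNorm_g3cLocInv_le_of_coer`, `continuousOn_g3cLocInv_apply_of_coer`, `g3cAq_mul_locInv_of_coer`, ★`g3c_parametrix_of_coer`
(`(x·1 + [TC φ]_{nonB₀})·C₀ = 1 + R` wherever every `5^d` block is coercive), `norm_trace_root_mul_prod_le_of_coer`, `norm_g3cWalkTerm_le_of_coer`.

HONEST FRAMING.  A definition (a predicate WITH PARAMETERS — asserts nothing) and elementary letters under point hypotheses; nothing of Bałaban asserted, ported or discharged; `stub_G3C`
NOT closed; 27930 OPEN; NODE O 0∕1; COUNT 8∕28 · K 1∕4 UNMOVED; finite `𝕋⁴_{L^K}` at fixed ε — NOT continuum ∕ OS ∕ Clay; **the Yang–Mills mass gap is NOT proved by any of this.**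
No `sorry`, no `instance`, no `notation`; standard axioms.
-/

noncomputable section

open scoped BigOperators Matrix.Norms.L2Operator Topology Matrix Classical
open Filter Finset

namespace Summit.QuantumFields.YangMills.Theorems.BalabanUVNodesPortS1

open Summit.QuantumFields.YangMills.Theorems.K0RecordFormatNames
open Literature.MathematicalPhysics.QuantumFieldTheory.Balaban1983to89
open Literature.MathematicalPhysics.QuantumFieldTheory.Balaban1983to89.Node00
open Literature.MathematicalPhysics.QuantumFieldTheory.Balaban1983to89.T4Continuum (T4Family)
open Literature.MathematicalPhysics.QuantumFieldTheory.Balaban1983to89.TreeLengthTorus (TPt)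
open Literature.MathematicalPhysics.QuantumFieldTheory.Balaban1983to89.B5Prop11Lower (nsq nsq_nonneg)

/-! ## §1  The point predicate -/

section Defs

variable (F : T4Family)

/-- ★ **`G3CPt` — THE CARRIER CLAUSES AT ONE PAIR `φ` with constants `(c, γ)`, localized in `X`**: (i) for every `Y ⊆ X`, the Schur ROW and COLUMN sums of `T_Y(φ)` weighted by
`exp(δ₁·tdist_k)` are `≤ c·e^{−δ₀·d_j(Y)}` ((P4-lat) at `φ`); (ii) for every domain `Z ⊆ X`, the block `T^{(Z)}(φ)|_Z` is `Re`-coercive with constant `γ` ((P5ᶜ) at `φ`, subtype form).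
A predicate WITH PARAMETERS — asserts nothing; on the record space of `X` it holds with `(c₀, γ₀)` (`g3cPt_of_mem`), near it with `(2c₀, γ₀∕2)`.
[cite: Balaban1985BackgroundPropagators, (3.42) p.399; Balaban1987RG1, (1.18) p.263, (2.11) p.267; Balaban1983RegularityDecay, (5.6) p.594] -/
def G3CPt (Mc k K : ℕ) (TYK : (recordDomSys F Mc k K).Dom → Sect2.CPair (F.P K) (MatA 2) → FluctIdx F k K → FluctIdx F k K → ℂ)
    (c γ δ₀ δ₁ : ℝ) (X : (recordDomSys F Mc k K).Dom) (φ : Sect2.CPair (F.P K) (MatA 2)) : Prop :=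
  (∀ Y : (recordDomSys F Mc k K).Dom, Y.1 ⊆ X.1 →
    (∀ i : FluctIdx F k K, ∑ j : FluctIdx F k K, ‖TYK Y φ i j‖ * Real.exp (δ₁ * (Site.tdist i.1.src j.1.src : ℝ)) ≤
        c * Real.exp (-(δ₀ * (recordDomSys F Mc k K).dj Y))) ∧
    (∀ j : FluctIdx F k K, ∑ i : FluctIdx F k K, ‖TYK Y φ i j‖ * Real.exp (δ₁ * (Site.tdist i.1.src j.1.src : ℝ)) ≤
        c * Real.exp (-(δ₀ * (recordDomSys F Mc k K).dj Y)))) ∧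
  (∀ Z : (recordDomSys F Mc k K).Dom, Z.1 ⊆ X.1 →
    ∀ z : {i : NonB0Idx F k K // g3cInDom F Mc k K Z i} → ℂ,
      γ * nsq z ≤ (star z ⬝ᵥ ((g3cLocOp F Mc k K TYK Z φ).submatrix
        (Subtype.val : {i : NonB0Idx F k K // g3cInDom F Mc k K Z i} → NonB0Idx F k K) Subtype.val *ᵥ z)).re)

end Defs

/-! ## §2  The predicate on the record space; monotonicity -/

section Record

variable {F : T4Family}
variable {a₀ δ₀ c₀ γ₀ γ₁ δ₁ : ℝ} {Mc : ℕ} {α₀ α₁ ε₂₉ : ℝ} {k : ℕ}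
variable {TC : (n : ℕ) → Sect2.CPair (F.P (recordK₀ F Mc k + n)) (MatA 2) → FluctIdx F k (recordK₀ F Mc k + n) → FluctIdx F k (recordK₀ F Mc k + n) → ℂ}
variable {TY : (n : ℕ) → (recordDomSys F Mc k (recordK₀ F Mc k + n)).Dom → Sect2.CPair (F.P (recordK₀ F Mc k + n)) (MatA 2) →
  FluctIdx F k (recordK₀ F Mc k + n) → FluctIdx F k (recordK₀ F Mc k + n) → ℂ}
variable {TZY : Finset (Fin 4 → ℤ) → IntBondCfg → ((Fin 4 → ℤ) × Fin 4) × Fin 3 → ((Fin 4 → ℤ) × Fin 4) × Fin 3 → ℂ}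
variable {AdM : (n : ℕ) → (Site (F.P (recordK₀ F Mc k + n)) 0 → (MatA 2)ˣ) →
  Matrix (FluctIdx F k (recordK₀ F Mc k + n)) (FluctIdx F k (recordK₀ F Mc k + n)) ℂ}
variable {AdZ : ((Fin 4 → ℤ) → (MatA 2)ˣ) → (Fin 4 → ℤ) × Fin 4 → Matrix (Fin 3) (Fin 3) ℂ}

/-- ★ **ON THE RECORD SPACE OF `X` THE POINT PREDICATE HOLDS WITH `(c₀, γ₀)`** ((P4-lat) and (P5ᶜ) read at `φ ∈ U^c(X) ⊆ U^c(Y)`, `Y ⊆ X`, ✓`recordUc_antitone`).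
[cite: Balaban1987RG1, (1.16) p.263; Balaban1985BackgroundPropagators, (3.42) p.399] -/
theorem g3cPt_of_mem (hP : P0CarrierClauses F a₀ δ₀ c₀ γ₀ γ₁ Mc α₀ α₁ ε₂₉ k TC TY TZY AdM AdZ) (hL : P0CarrierLatticeDecay F δ₀ c₀ δ₁ Mc α₀ α₁ k TY) (n : ℕ)
    (X : (recordDomSys F Mc k (recordK₀ F Mc k + n)).Dom) {φ : Sect2.CPair (F.P (recordK₀ F Mc k + n)) (MatA 2)}
    (hφ : encodeCfg F (recordK₀ F Mc k + n) φ ∈ recordUc F Mc k α₀ α₁ (recordK₀ F Mc k + n) X) :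
    G3CPt F Mc k (recordK₀ F Mc k + n) (TY n) c₀ γ₀ δ₀ δ₁ X φ :=
  ⟨fun Y hY => hL n Y φ (recordUc_antitone F hY hφ), fun Z hZ z => g3cLocBlock_reCoercive hP n Z (recordUc_antitone F hZ hφ) z⟩

/-- The point predicate is ANTITONE in the localization domain: `X' ⊆ X ⟹ G3CPt X φ → G3CPt X' φ`. [folklore] -/
theorem G3CPt.mono {Mc k K : ℕ} {TYK : (recordDomSys F Mc k K).Dom → Sect2.CPair (F.P K) (MatA 2) → FluctIdx F k K → FluctIdx F k K → ℂ}
    {c γ δ₀' δ₁' : ℝ} {X X' : (recordDomSys F Mc k K).Dom} {φ : Sect2.CPair (F.P K) (MatA 2)}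
    (h : G3CPt F Mc k K TYK c γ δ₀' δ₁' X φ) (hX : X'.1 ⊆ X.1) : G3CPt F Mc k K TYK c γ δ₀' δ₁' X' φ :=
  ⟨fun Y hY => h.1 Y (hY.trans hX), fun Z hZ => h.2 Z (hZ.trans hX)⟩

/-- The coercivity clause of the point predicate at a sub-domain `Z ⊆ X`. [folklore] -/
theorem G3CPt.coer {Mc k K : ℕ} {TYK : (recordDomSys F Mc k K).Dom → Sect2.CPair (F.P K) (MatA 2) → FluctIdx F k K → FluctIdx F k K → ℂ}
    {c γ δ₀' δ₁' : ℝ} {X : (recordDomSys F Mc k K).Dom} {φ : Sect2.CPair (F.P K) (MatA 2)}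
    (h : G3CPt F Mc k K TYK c γ δ₀' δ₁' X φ) {Z : (recordDomSys F Mc k K).Dom} (hZ : Z.1 ⊆ X.1) :
    ∀ z : {i : NonB0Idx F k K // g3cInDom F Mc k K Z i} → ℂ,
      γ * nsq z ≤ (star z ⬝ᵥ ((g3cLocOp F Mc k K TYK Z φ).submatrix
        (Subtype.val : {i : NonB0Idx F k K // g3cInDom F Mc k K Z i} → NonB0Idx F k K) Subtype.val *ᵥ z)).re :=
  h.2 Z hZ

/-- The unweighted Schur ROW sums follow from the weighted ones (`δ₁ ≥ 0`, weight `≥ 1`). [folklore] -/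
theorem G3CPt.row_le {Mc k K : ℕ} {TYK : (recordDomSys F Mc k K).Dom → Sect2.CPair (F.P K) (MatA 2) → FluctIdx F k K → FluctIdx F k K → ℂ}
    {c γ δ₀' δ₁' : ℝ} {X : (recordDomSys F Mc k K).Dom} {φ : Sect2.CPair (F.P K) (MatA 2)}
    (h : G3CPt F Mc k K TYK c γ δ₀' δ₁' X φ) (hδ₁ : 0 ≤ δ₁') {Y : (recordDomSys F Mc k K).Dom} (hY : Y.1 ⊆ X.1) (i : FluctIdx F k K) :
    ∑ j : FluctIdx F k K, ‖TYK Y φ i j‖ ≤ c * Real.exp (-(δ₀' * (recordDomSys F Mc k K).dj Y)) := by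
  refine le_trans (Finset.sum_le_sum fun j _ => ?_) ((h.1 Y hY).1 i)
  have h1 : (1 : ℝ) ≤ Real.exp (δ₁' * (Site.tdist i.1.src j.1.src : ℝ)) := Real.one_le_exp (by positivity)
  simpa using mul_le_mul_of_nonneg_left h1 (norm_nonneg (TYK Y φ i j))

/-- The unweighted Schur COLUMN sums follow from the weighted ones. [folklore] -/
theorem G3CPt.col_le {Mc k K : ℕ} {TYK : (recordDomSys F Mc k K).Dom → Sect2.CPair (F.P K) (MatA 2) → FluctIdx F k K → FluctIdx F k K → ℂ}
    {c γ δ₀' δ₁' : ℝ} {X : (recordDomSys F Mc k K).Dom} {φ : Sect2.CPair (F.P K) (MatA 2)}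
    (h : G3CPt F Mc k K TYK c γ δ₀' δ₁' X φ) (hδ₁ : 0 ≤ δ₁') {Y : (recordDomSys F Mc k K).Dom} (hY : Y.1 ⊆ X.1) (j : FluctIdx F k K) :
    ∑ i : FluctIdx F k K, ‖TYK Y φ i j‖ ≤ c * Real.exp (-(δ₀' * (recordDomSys F Mc k K).dj Y)) := by
  refine le_trans (Finset.sum_le_sum fun i _ => ?_) ((h.1 Y hY).2 j)
  have h1 : (1 : ℝ) ≤ Real.exp (δ₁' * (Site.tdist i.1.src j.1.src : ℝ)) := Real.one_le_exp (by positivity)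
  simpa using mul_le_mul_of_nonneg_left h1 (norm_nonneg (TYK Y φ i j))

/-- The constant `c` of a point predicate is `≥ 0` as soon as `X` has a sub-domain (itself). [folklore] -/
theorem G3CPt.nonneg {Mc k K : ℕ} {TYK : (recordDomSys F Mc k K).Dom → Sect2.CPair (F.P K) (MatA 2) → FluctIdx F k K → FluctIdx F k K → ℂ}
    {c γ δ₀' δ₁' : ℝ} {X : (recordDomSys F Mc k K).Dom} {φ : Sect2.CPair (F.P K) (MatA 2)}
    (h : G3CPt F Mc k K TYK c γ δ₀' δ₁' X φ) (i : FluctIdx F k K) : 0 ≤ c := by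
  have h1 := (h.1 X le_rfl).1 i
  have h0 : 0 ≤ ∑ j : FluctIdx F k K, ‖TYK X φ i j‖ * Real.exp (δ₁' * (Site.tdist i.1.src j.1.src : ℝ)) :=
    Finset.sum_nonneg fun j _ => by positivity
  exact nonneg_of_mul_nonneg_left (h0.trans h1) (Real.exp_pos _)

end Record

/-! ## §3  Bricks re-keyed on the coercivity AT THE PAIR: units, `‖G_Z‖ ≤ 1/γ`, continuity in `x`, the parametrix, the walk-term majorant -/

section Coer

variable {F : T4Family}
variable {a₀ δ₀ c₀ γ₀ γ₁ δ₁ : ℝ} {Mc : ℕ} {α₀ α₁ ε₂₉ : ℝ} {k : ℕ}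
variable {TC : (n : ℕ) → Sect2.CPair (F.P (recordK₀ F Mc k + n)) (MatA 2) → FluctIdx F k (recordK₀ F Mc k + n) → FluctIdx F k (recordK₀ F Mc k + n) → ℂ}
variable {TY : (n : ℕ) → (recordDomSys F Mc k (recordK₀ F Mc k + n)).Dom → Sect2.CPair (F.P (recordK₀ F Mc k + n)) (MatA 2) →
  FluctIdx F k (recordK₀ F Mc k + n) → FluctIdx F k (recordK₀ F Mc k + n) → ℂ}
variable {TZY : Finset (Fin 4 → ℤ) → IntBondCfg → ((Fin 4 → ℤ) × Fin 4) × Fin 3 → ((Fin 4 → ℤ) × Fin 4) × Fin 3 → ℂ}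
variable {AdM : (n : ℕ) → (Site (F.P (recordK₀ F Mc k + n)) 0 → (MatA 2)ˣ) →
  Matrix (FluctIdx F k (recordK₀ F Mc k + n)) (FluctIdx F k (recordK₀ F Mc k + n)) ℂ}
variable {AdZ : ((Fin 4 → ℤ) → (MatA 2)ˣ) → (Fin 4 → ℤ) × Fin 4 → Matrix (Fin 3) (Fin 3) ℂ}

/-- **Unit** from coercivity at the pair: `x·1 + T^{(Z)}(φ)|_Z` is a unit for `x ≥ 0`. [cite: Balaban1985UV3, p.272 (after (63))] -/
theorem isUnit_det_g3cLocBlock_of_coer {K : ℕ} (Mc k : ℕ) (TYK : (recordDomSys F Mc k K).Dom → Sect2.CPair (F.P K) (MatA 2) → FluctIdx F k K → FluctIdx F k K → ℂ)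
    {γ : ℝ} (hγ : 0 < γ) (Z : (recordDomSys F Mc k K).Dom) {φ : Sect2.CPair (F.P K) (MatA 2)}
    (hco : ∀ z : {i : NonB0Idx F k K // g3cInDom F Mc k K Z i} → ℂ,
      γ * nsq z ≤ (star z ⬝ᵥ ((g3cLocOp F Mc k K TYK Z φ).submatrix
        (Subtype.val : {i : NonB0Idx F k K // g3cInDom F Mc k K Z i} → NonB0Idx F k K) Subtype.val *ᵥ z)).re)
    {x : ℝ} (hx : 0 ≤ x) : IsUnit (g3cLocBlock F Mc k K TYK Z x φ).det :=
  G3CCT.isUnit_det_realSmul_one_add hγ hco hx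

/-- **`‖G_Z(x, φ) i j‖ ≤ 1/γ`** from coercivity at the pair (`x ≥ 0`; entries off `Z` vanish). [cite: Balaban1985UV3, p.272 (after (63)); Balaban1987RG1, (1.18) p.263] -/
theorem norm_g3cLocInv_apply_le_of_coer {K : ℕ} (Mc k : ℕ) (TYK : (recordDomSys F Mc k K).Dom → Sect2.CPair (F.P K) (MatA 2) → FluctIdx F k K → FluctIdx F k K → ℂ)
    {γ : ℝ} (hγ : 0 < γ) (Z : (recordDomSys F Mc k K).Dom) {φ : Sect2.CPair (F.P K) (MatA 2)}
    (hco : ∀ z : {i : NonB0Idx F k K // g3cInDom F Mc k K Z i} → ℂ,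
      γ * nsq z ≤ (star z ⬝ᵥ ((g3cLocOp F Mc k K TYK Z φ).submatrix
        (Subtype.val : {i : NonB0Idx F k K // g3cInDom F Mc k K Z i} → NonB0Idx F k K) Subtype.val *ᵥ z)).re)
    {x : ℝ} (hx : 0 ≤ x) (i j : NonB0Idx F k K) :
    ‖g3cLocInv F Mc k K TYK Z x φ i j‖ ≤ 1 / γ := by
  by_cases hi : g3cInDom F Mc k K Z i
  · by_cases hj : g3cInDom F Mc k K Z j
    · rw [g3cLocInv_apply_of_mem Mc k K TYK Z x φ hi hj, g3cLocBlock]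
      exact G3CCT.norm_resolvent_apply_le_of_reCoercive hγ hco hx _ _
    · rw [g3cLocInv_apply_of_not_mem Mc k K TYK Z x φ (Or.inr hj), norm_zero]; positivity
  · rw [g3cLocInv_apply_of_not_mem Mc k K TYK Z x φ (Or.inl hi), norm_zero]; positivity

/-- **`‖G_Z(x, φ)‖ ≤ 1/γ`** (`ℓ²`-operator norm) from coercivity at the pair. [cite: Balaban1985UV3, p.272 (after (63)); Balaban1985BackgroundPropagators, (3.42) p.399] -/
theorem l2_opNorm_g3cLocInv_le_of_coer {K : ℕ} (Mc k : ℕ) (TYK : (recordDomSys F Mc k K).Dom → Sect2.CPair (F.P K) (MatA 2) → FluctIdx F k K → FluctIdx F k K → ℂ)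
    {γ : ℝ} (hγ : 0 < γ) (Z : (recordDomSys F Mc k K).Dom) {φ : Sect2.CPair (F.P K) (MatA 2)}
    (hco : ∀ z : {i : NonB0Idx F k K // g3cInDom F Mc k K Z i} → ℂ,
      γ * nsq z ≤ (star z ⬝ᵥ ((g3cLocOp F Mc k K TYK Z φ).submatrix
        (Subtype.val : {i : NonB0Idx F k K // g3cInDom F Mc k K Z i} → NonB0Idx F k K) Subtype.val *ᵥ z)).re)
    {x : ℝ} (hx : 0 ≤ x) : ‖g3cLocInv F Mc k K TYK Z x φ‖ ≤ 1 / γ := by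
  rw [g3cLocInv_eq_extend]
  refine (G3CInv.l2_opNorm_extend_le _).trans ?_
  rw [g3cLocBlock]
  exact G3CCT.l2_opNorm_resolvent_le_of_reCoercive hγ hco hx

/-- **Continuity in `x ≥ 0`** of the entries of `G_Z(·, φ)` from coercivity at the pair. [cite: Balaban1985UV3, p.272 (after (63))] -/
theorem continuousOn_g3cLocInv_apply_of_coer {K : ℕ} (Mc k : ℕ) (TYK : (recordDomSys F Mc k K).Dom → Sect2.CPair (F.P K) (MatA 2) → FluctIdx F k K → FluctIdx F k K → ℂ)
    {γ : ℝ} (hγ : 0 < γ) (Z : (recordDomSys F Mc k K).Dom) {φ : Sect2.CPair (F.P K) (MatA 2)}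
    (hco : ∀ z : {i : NonB0Idx F k K // g3cInDom F Mc k K Z i} → ℂ,
      γ * nsq z ≤ (star z ⬝ᵥ ((g3cLocOp F Mc k K TYK Z φ).submatrix
        (Subtype.val : {i : NonB0Idx F k K // g3cInDom F Mc k K Z i} → NonB0Idx F k K) Subtype.val *ᵥ z)).re)
    (i j : NonB0Idx F k K) :
    ContinuousOn (fun x : ℝ => g3cLocInv F Mc k K TYK Z x φ i j) (Set.Ici 0) := by
  by_cases hi : g3cInDom F Mc k K Z i
  · by_cases hj : g3cInDom F Mc k K Z j
    · simp only [g3cLocInv_apply_of_mem Mc k K TYK Z _ φ hi hj, g3cLocBlock]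
      exact G3CCT.continuousOn_resolvent_apply_of_reCoercive hγ hco _ _
    · simp only [g3cLocInv_apply_of_not_mem Mc k K TYK Z _ φ (Or.inr hj)]; exact continuousOn_const
  · simp only [g3cLocInv_apply_of_not_mem Mc k K TYK Z _ φ (Or.inl hi)]; exact continuousOn_const

/-- **`A_□(x, φ)·G_□(x, φ) = P_□̃`** wherever the block `□̃` is coercive at the pair. [cite: Balaban1985BackgroundPropagators, (3.88) p.409] -/
theorem g3cAq_mul_locInv_of_coer (hP : P0CarrierClauses F a₀ δ₀ c₀ γ₀ γ₁ Mc α₀ α₁ ε₂₉ k TC TY TZY AdM AdZ) {γ : ℝ} (hγ : 0 < γ) (n : ℕ)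
    (q : TPt (F.P (recordK₀ F Mc k + n)).d (Sect2.domCount (F.P (recordK₀ F Mc k + n)) Mc (k + 1))) {φ : Sect2.CPair (F.P (recordK₀ F Mc k + n)) (MatA 2)}
    (hco : ∀ z : {i : NonB0Idx F k (recordK₀ F Mc k + n) // g3cInDom F Mc k (recordK₀ F Mc k + n) (g3cBlk F Mc k (recordK₀ F Mc k + n) q) i} → ℂ,
      γ * nsq z ≤ (star z ⬝ᵥ ((g3cLocOp F Mc k (recordK₀ F Mc k + n) (TY n) (g3cBlk F Mc k (recordK₀ F Mc k + n) q) φ).submatrix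
        (Subtype.val : {i : NonB0Idx F k (recordK₀ F Mc k + n) // g3cInDom F Mc k (recordK₀ F Mc k + n) (g3cBlk F Mc k (recordK₀ F Mc k + n) q) i} → _)
        Subtype.val *ᵥ z)).re)
    {x : ℝ} (hx : 0 ≤ x) :
    g3cAq F Mc k (recordK₀ F Mc k + n) (TY n) q x φ * g3cLocInv F Mc k (recordK₀ F Mc k + n) (TY n) (g3cBlk F Mc k (recordK₀ F Mc k + n) q) x φ =
      g3cProj F Mc k (recordK₀ F Mc k + n) (g3cBlk F Mc k (recordK₀ F Mc k + n) q) := by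
  rw [g3cAq_eq_extend hP n q x φ, g3cLocInv_eq_extend, G3CInv.extend_mul,
    Matrix.mul_nonsing_inv _ (isUnit_det_g3cLocBlock_of_coer Mc k (TY n) hγ _ hco hx), G3CInv.extend_one]
  rfl

/-- ★ **THE ONE-SIDED PARAMETRIX IDENTITY WHEREVER EVERY `5^d` BLOCK IS COERCIVE AT THE PAIR** (e.g. under `G3CPt … X_full φ`): for `x ≥ 0`,
`(x·1 + [TC n φ]_{nonB₀})·C₀(x, φ) = 1 + R(x, φ)`. [cite: Balaban1985BackgroundPropagators, (3.87)–(3.88) p.409, (3.95)–(3.96) p.411] -/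
theorem g3c_parametrix_of_coer (hP : P0CarrierClauses F a₀ δ₀ c₀ γ₀ γ₁ Mc α₀ α₁ ε₂₉ k TC TY TZY AdM AdZ) {γ : ℝ} (hγ : 0 < γ) (hMc : McGuard F Mc) (n : ℕ)
    {φ : Sect2.CPair (F.P (recordK₀ F Mc k + n)) (MatA 2)}
    (hco : ∀ q : TPt (F.P (recordK₀ F Mc k + n)).d (Sect2.domCount (F.P (recordK₀ F Mc k + n)) Mc (k + 1)),
      ∀ z : {i : NonB0Idx F k (recordK₀ F Mc k + n) // g3cInDom F Mc k (recordK₀ F Mc k + n) (g3cBlk F Mc k (recordK₀ F Mc k + n) q) i} → ℂ,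
      γ * nsq z ≤ (star z ⬝ᵥ ((g3cLocOp F Mc k (recordK₀ F Mc k + n) (TY n) (g3cBlk F Mc k (recordK₀ F Mc k + n) q) φ).submatrix
        (Subtype.val : {i : NonB0Idx F k (recordK₀ F Mc k + n) // g3cInDom F Mc k (recordK₀ F Mc k + n) (g3cBlk F Mc k (recordK₀ F Mc k + n) q) i} → _)
        Subtype.val *ᵥ z)).re)
    {x : ℝ} (hx : 0 ≤ x) :
    ((x : ℂ) • (1 : Matrix _ _ ℂ) + nonB0Block F k (recordK₀ F Mc k + n) (TC n φ)) * g3cC0 F Mc k (recordK₀ F Mc k + n) (TY n) x φ =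
      1 + g3cR F Mc k (recordK₀ F Mc k + n) (TC n) (TY n) x φ := by
  have hK : recordK₀ F Mc k ≤ recordK₀ F Mc k + n := Nat.le_add_right _ _
  rw [g3cC0, g3cR]
  simp only [g3cInd]
  refine G3CInv.parametrix_identity_oneSided Finset.univ _ (fun q (i : NonB0Idx F k (recordK₀ F Mc k + n)) =>
      if cubeOfSite F Mc k (recordK₀ F Mc k + n) (blockOf i.1.1.src) = q then (1 : ℝ) else 0)
    (fun q => g3cLocInv F Mc k (recordK₀ F Mc k + n) (TY n) (g3cBlk F Mc k (recordK₀ F Mc k + n) q) x φ)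
    (fun q => g3cProj F Mc k (recordK₀ F Mc k + n) (g3cBlk F Mc k (recordK₀ F Mc k + n) q))
    (fun q => g3cE F Mc k (recordK₀ F Mc k + n) (TC n) (TY n) q x φ)
    (fun i => by rw [Finset.sum_ite_eq, if_pos (Finset.mem_univ _)]) (fun q _ => ?_) (fun q _ => ?_)
  · have h := g3cProj_mul_ind (F := F) hMc hK q
    rw [g3cInd] at h
    exact h
  · exact G3CInv.localInverse_letter _ (g3cAq F Mc k (recordK₀ F Mc k + n) (TY n) q x φ) _ _ _
      (g3cAq_mul_locInv_of_coer hP hγ n q (hco q) hx) (g3cProj_mul_locInv Mc k _ (TY n) _ x φ) rfl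

/-- **The rooted trace bound from coercivity at the pair**: `|Tr[G_{□₀}𝟙_{□₀}·M]| ≤ N_□·(1∕γ)·‖M‖`. [cite: Balaban1985UV3, (25) p.262; Balaban1985BackgroundPropagators, (3.96) p.411] -/
theorem norm_trace_root_mul_le_of_coer (hMc : McGuard F Mc) {γ : ℝ} (hγ : 0 < γ) (n : ℕ)
    (q₀ : TPt (F.P (recordK₀ F Mc k + n)).d (Sect2.domCount (F.P (recordK₀ F Mc k + n)) Mc (k + 1))) {φ : Sect2.CPair (F.P (recordK₀ F Mc k + n)) (MatA 2)}
    (hco : ∀ z : {i : NonB0Idx F k (recordK₀ F Mc k + n) // g3cInDom F Mc k (recordK₀ F Mc k + n) (g3cBlk F Mc k (recordK₀ F Mc k + n) q₀) i} → ℂ,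
      γ * nsq z ≤ (star z ⬝ᵥ ((g3cLocOp F Mc k (recordK₀ F Mc k + n) (TY n) (g3cBlk F Mc k (recordK₀ F Mc k + n) q₀) φ).submatrix
        (Subtype.val : {i : NonB0Idx F k (recordK₀ F Mc k + n) // g3cInDom F Mc k (recordK₀ F Mc k + n) (g3cBlk F Mc k (recordK₀ F Mc k + n) q₀) i} → _)
        Subtype.val *ᵥ z)).re)
    {x : ℝ} (hx : 0 ≤ x) (M : Matrix (NonB0Idx F k (recordK₀ F Mc k + n)) (NonB0Idx F k (recordK₀ F Mc k + n)) ℂ) :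
    ‖(g3cLocInv F Mc k (recordK₀ F Mc k + n) (TY n) (g3cBlk F Mc k (recordK₀ F Mc k + n) q₀) x φ * g3cInd F Mc k (recordK₀ F Mc k + n) q₀ * M).trace‖ ≤
      (3 * (F.P (recordK₀ F Mc k + n)).d * (F.L * Mc) ^ (F.P (recordK₀ F Mc k + n)).d : ℕ) * (1 / γ) * ‖M‖ := by
  have hK : recordK₀ F Mc k ≤ recordK₀ F Mc k + n := Nat.le_add_right _ _
  set G := g3cLocInv F Mc k (recordK₀ F Mc k + n) (TY n) (g3cBlk F Mc k (recordK₀ F Mc k + n) q₀) x φ with hGdef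
  have hG : ‖G‖ ≤ 1 / γ := l2_opNorm_g3cLocInv_le_of_coer Mc k (TY n) hγ _ hco hx
  rw [Matrix.mul_assoc, Matrix.trace_mul_comm, g3cInd]
  have hcast : (fun i : NonB0Idx F k (recordK₀ F Mc k + n) => (((if cubeOfSite F Mc k (recordK₀ F Mc k + n) (blockOf i.1.1.src) = q₀ then (1 : ℝ) else 0 : ℝ)) : ℂ)) =
      fun i => if cubeOfSite F Mc k (recordK₀ F Mc k + n) (blockOf i.1.1.src) = q₀ then (1 : ℂ) else 0 := by
    funext i; split_ifs <;> simp
  rw [hcast, Matrix.mul_assoc]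
  refine (G3CCT.norm_trace_diagonal_mul_le _ _).trans ?_
  have hcnt : ((univ.filter fun i : NonB0Idx F k (recordK₀ F Mc k + n) => cubeOfSite F Mc k (recordK₀ F Mc k + n) (blockOf i.1.1.src) = q₀).card : ℝ) ≤
      (3 * (F.P (recordK₀ F Mc k + n)).d * (F.L * Mc) ^ (F.P (recordK₀ F Mc k + n)).d : ℕ) := by
    exact_mod_cast card_filter_cube_le hMc hK q₀
  have hMG : ‖M * G‖ ≤ ‖M‖ * (1 / γ) := (norm_mul_le _ _).trans (mul_le_mul_of_nonneg_left hG (norm_nonneg _))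
  calc ((univ.filter fun i : NonB0Idx F k (recordK₀ F Mc k + n) => cubeOfSite F Mc k (recordK₀ F Mc k + n) (blockOf i.1.1.src) = q₀).card : ℝ) * ‖M * G‖
      ≤ (3 * (F.P (recordK₀ F Mc k + n)).d * (F.L * Mc) ^ (F.P (recordK₀ F Mc k + n)).d : ℕ) * (‖M‖ * (1 / γ)) :=
        mul_le_mul hcnt hMG (norm_nonneg _) (by positivity)
    _ = _ := by ring

/-- ★ **THE WALK-TERM MAJORANT from coercivity at the pair**: `|t(□₀, w)| ≤ N_□·(1∕γ)·Π_i ‖S^M(w_i)‖`. [cite: Balaban1985UV3, (25) p.262; Balaban1985BackgroundPropagators, (3.96) p.411] -/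
theorem norm_g3cWalkTerm_le_of_coer (hMc : McGuard F Mc) {γ : ℝ} (hγ : 0 < γ) (n : ℕ)
    (q₀ : TPt (F.P (recordK₀ F Mc k + n)).d (Sect2.domCount (F.P (recordK₀ F Mc k + n)) Mc (k + 1))) {φ : Sect2.CPair (F.P (recordK₀ F Mc k + n)) (MatA 2)}
    (hco : ∀ z : {i : NonB0Idx F k (recordK₀ F Mc k + n) // g3cInDom F Mc k (recordK₀ F Mc k + n) (g3cBlk F Mc k (recordK₀ F Mc k + n) q₀) i} → ℂ,
      γ * nsq z ≤ (star z ⬝ᵥ ((g3cLocOp F Mc k (recordK₀ F Mc k + n) (TY n) (g3cBlk F Mc k (recordK₀ F Mc k + n) q₀) φ).submatrix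
        (Subtype.val : {i : NonB0Idx F k (recordK₀ F Mc k + n) // g3cInDom F Mc k (recordK₀ F Mc k + n) (g3cBlk F Mc k (recordK₀ F Mc k + n) q₀) i} → _)
        Subtype.val *ᵥ z)).re)
    {x : ℝ} (hx : 0 ≤ x) {m : ℕ}
    (w : Fin m → TPt (F.P (recordK₀ F Mc k + n)).d (Sect2.domCount (F.P (recordK₀ F Mc k + n)) Mc (k + 1)) × (recordDomSys F Mc k (recordK₀ F Mc k + n)).Dom) :
    ‖g3cWalkTerm F Mc k (recordK₀ F Mc k + n) (TY n) x φ q₀ w‖ ≤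
      (3 * (F.P (recordK₀ F Mc k + n)).d * (F.L * Mc) ^ (F.P (recordK₀ F Mc k + n)).d : ℕ) * (1 / γ) *
        ∏ i : Fin m, ‖g3cStepM F Mc k (recordK₀ F Mc k + n) (TY n) x φ (w i)‖ := by
  have h := (norm_trace_root_mul_le_of_coer hMc hγ n q₀ hco hx (List.ofFn fun i => g3cStepM F Mc k (recordK₀ F Mc k + n) (TY n) x φ (w i)).prod).trans
    (mul_le_mul_of_nonneg_left (G3CCT.norm_list_prod_le (List.ofFn fun i => g3cStepM F Mc k (recordK₀ F Mc k + n) (TY n) x φ (w i))) (by positivity))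
  rw [List.map_ofFn, List.prod_ofFn] at h
  exact h

end Coer

end Summit.QuantumFields.YangMills.Theorems.BalabanUVNodesPortS1

end
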